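import Mathlib
import Literature.Computability.AlgebraicComplexity.PermanentIrreducible

/-!
# Crux `WordLengthQP` (stmt-ValiantsHypothesis-6623), line `Sketch` (eps-order-ladder) —
stub `stub_perTop`

Degree bookkeeping for the Allender–Wang 2016 restriction step applied to the permanent: an
ASSIGNMENT of constants `a v` to the cells `v ∈ Z` is the `ℂ`-algebra endomorphism
`aeval (fun v => if v ∈ Z then C (a v) else X v)`.  If some permutation avoids `Z` (cells
`(ρ i, i)`), then `per_n` after the assignment still has total degree `n`, and its degree-`n`
homogeneous component is the permanent of the zero pattern `Z`, i.e. the sum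
`∑_{ρ avoiding Z} X^{μ_ρ}` of the monomials of the `Z`-avoiding permutations (folklore; the term of
`ρ` after the assignment is `(∏_{hits} a) · X^{ν_ρ}` with `deg ν_ρ = n - #hits`).
-/

-- `Summit.ValiantsHypothesis.ValiantsHypothesis.…` is the tree's mandated single-conjunct layout
-- (Sub = Summit), so the duplicated namespace component is intended.
set_option linter.dupNamespace false

noncomputable section

open MvPolynomial

namespace Summit.ValiantsHypothesis.ValiantsHypothesis.Cruxes.WordLengthQP.EpsOrderLadder

open Literature.Computability.AlgebraicComplexity

/-- The degree of a sum of unit vectors `∑_{i ∈ s} e_{p i}` is `#s`. [folklore] -/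
theorem perTop_degree_sum_single {α τ : Type*} (s : Finset α) (p : α → τ) :
    (∑ i ∈ s, Finsupp.single (p i) (1 : ℕ)).degree = s.card := by
  rw [map_sum]
  simp

/-- The permanent after an assignment, term by term: the term of `ρ` becomes
`(∏_{i : (ρ i, i) ∈ Z} a (ρ i, i)) · ∏_{i : (ρ i, i) ∉ Z} X_{ρ i, i}`. [folklore] -/
theorem perTop_aeval_perPoly (n : ℕ) (Z : Finset (Fin n × Fin n)) (a : Fin n × Fin n → ℂ) :
    MvPolynomial.aeval
        (fun v : Fin n × Fin n => if v ∈ Z then MvPolynomial.C (a v) else MvPolynomial.X v)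
        (perPoly (Fin n) ℂ) =
      ∑ ρ : Equiv.Perm (Fin n),
        monomial (∑ i ∈ Finset.univ.filter (fun i => (ρ i, i) ∉ Z), Finsupp.single (ρ i, i) 1)
          (∏ i ∈ Finset.univ.filter (fun i => (ρ i, i) ∈ Z), a (ρ i, i)) := by
  unfold perPoly Matrix.permanent
  rw [map_sum]
  refine Finset.sum_congr rfl fun ρ _ => ?_
  rw [map_prod]
  simp only [Matrix.mvPolynomialX_apply, aeval_X]
  rw [Finset.prod_ite, monomial_sum_index, ← map_prod]
  rfl

/-- **stub_perTop**: after assigning constants to a set `Z` of cells that some permutation avoids,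
`per_n` keeps total degree `n`, and its degree-`n` part is the permanent of the zero pattern `Z`
(the sum of the monomials of the `Z`-avoiding permutations). [folklore] -/
theorem stub_perTop (n : ℕ) (Z : Finset (Fin n × Fin n)) (a : Fin n × Fin n → ℂ)
    (hZ : ∃ ρ : Equiv.Perm (Fin n), ∀ i, (ρ i, i) ∉ Z)
    (f : MvPolynomial (Fin n × Fin n) ℂ)
    (hf : f = MvPolynomial.aeval
      (fun v : Fin n × Fin n => if v ∈ Z then MvPolynomial.C (a v) else MvPolynomial.X v)
      (Literature.Computability.AlgebraicComplexity.perPoly (Fin n) ℂ)) :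
    f.totalDegree = n ∧
      MvPolynomial.homogeneousComponent n f =
        ∑ ρ ∈ (Finset.univ : Finset (Equiv.Perm (Fin n))).filter (fun ρ => ∀ i, (ρ i, i) ∉ Z),
          MvPolynomial.monomial (Literature.Computability.AlgebraicComplexity.permMonomial ρ)
            (1 : ℂ) := by
  obtain ⟨ρ₀, hρ₀⟩ := hZ
  have hf' := hf.trans (perTop_aeval_perPoly n Z a)
  have hu : (Finset.univ : Finset (Fin n)).card = n := by simp
  -- degrees of the restricted permutation monomials
  have hdeg : ∀ ρ : Equiv.Perm (Fin n),
      (∑ i ∈ Finset.univ.filter (fun i => (ρ i, i) ∉ Z),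
          Finsupp.single (ρ i, i) (1 : ℕ)).degree =
        (Finset.univ.filter (fun i => (ρ i, i) ∉ Z)).card :=
    fun ρ => perTop_degree_sum_single _ _
  have hle : ∀ ρ : Equiv.Perm (Fin n), (Finset.univ.filter (fun i => (ρ i, i) ∉ Z)).card ≤ n :=
    fun ρ => (Finset.card_filter_le _ _).trans hu.le
  have hiff : ∀ ρ : Equiv.Perm (Fin n),
      (Finset.univ.filter (fun i => (ρ i, i) ∉ Z)).card = n ↔ ∀ i, (ρ i, i) ∉ Z := by
    intro ρ
    constructor
    · intro h
      have h' := Finset.card_filter_eq_iff.1 (h.trans hu.symm)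
      exact fun i => h' i (Finset.mem_univ i)
    · intro h
      rw [Finset.filter_true_of_mem fun i _ => h i, hu]
  -- avoiding permutations: full monomial, trivial constant
  have hav : ∀ ρ : Equiv.Perm (Fin n), (∀ i, (ρ i, i) ∉ Z) →
      (∑ i ∈ Finset.univ.filter (fun i => (ρ i, i) ∉ Z), Finsupp.single (ρ i, i) (1 : ℕ)) =
          permMonomial ρ ∧
        (∏ i ∈ Finset.univ.filter (fun i => (ρ i, i) ∈ Z), a (ρ i, i)) = 1 := by
    intro ρ h
    constructor
    · rw [Finset.filter_true_of_mem fun i _ => h i]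
      rfl
    · rw [Finset.filter_false_of_mem fun i _ => h i, Finset.prod_empty]
  -- the degree-`n` component
  have htop : MvPolynomial.homogeneousComponent n f =
      ∑ ρ ∈ (Finset.univ : Finset (Equiv.Perm (Fin n))).filter (fun ρ => ∀ i, (ρ i, i) ∉ Z),
        MvPolynomial.monomial (permMonomial ρ) (1 : ℂ) := by
    rw [hf', map_sum, Finset.sum_filter]
    refine Finset.sum_congr rfl fun ρ _ => ?_
    rw [homogeneousComponent_of_mem (isHomogeneous_monomial _ (hdeg ρ))]
    by_cases h : ∀ i, (ρ i, i) ∉ Z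
    · obtain ⟨h1, h2⟩ := hav ρ h
      rw [if_pos ((hiff ρ).2 h).symm, if_pos h, h1, h2]
    · rw [if_neg fun h' => h ((hiff ρ).1 h'.symm), if_neg h]
  refine ⟨le_antisymm ?_ ?_, htop⟩
  · -- `totalDegree f ≤ n`, term by term
    rw [hf']
    exact totalDegree_finsetSum_le fun ρ _ =>
      (isHomogeneous_monomial _ (hdeg ρ)).totalDegree_le.trans (hle ρ)
  · -- `n ≤ totalDegree f`: the coefficient of `X^{μ_{ρ₀}}` in the top component is `1`
    by_contra hlt
    have h0 := homogeneousComponent_eq_zero n f (not_le.1 hlt)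
    have key := congrArg (coeff (permMonomial ρ₀)) htop
    rw [h0, coeff_zero, coeff_sum, Finset.sum_eq_single ρ₀] at key
    · rw [coeff_monomial, if_pos rfl] at key
      exact zero_ne_one key
    · intro π _ hπ
      rw [coeff_monomial, if_neg (permMonomial_injective.ne hπ)]
    · intro h
      exact absurd (Finset.mem_filter.2 ⟨Finset.mem_univ _, hρ₀⟩) h

end Summit.ValiantsHypothesis.ValiantsHypothesis.Cruxes.WordLengthQP.EpsOrderLadder
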